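import Mathlib
import HarnessLib
import Summits.HubbardSuperconductivity.HubbardSuperconductivity.Theorems.KLProgrammeKLRegimeSplitBornOddnessKernel

/-!
# Route `KLProgramme` — ENGINE (stmt-HubbardSuperconductivity-20437 `KLRegimeEngineV17F2`), cure (C′) of located #22, brick O5b (row form):
# THE LOCALISED PART OF THE BORN ROW `RS` IN THE ROWS DOOR'S OWN SPELLING — `Ẇ_t(p)·(βL²ĝ)·Φ_j(t)(p)·(βL²ĝ)` against `T_σ·(zω·iω_p + ze·e_K(p))`
# (cell gate-hubbard-kl, seat hubbard-kl-k3c2-p2 g31, technique «thermal-bar induction n ≤ nScales β + 1 with EngineBoundsAtV4S sums»)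

WHY.  CURE-C-PRIME-DESIGN §2 row 1, in Lean: the born line of binder #9 (`born_member_row_signed_le_quarter`, …OutClassBornSigned) with the kernel product
`V6·Sg` replaced by its LOCALISED LEADING PART `T_σ·(zω·iω_p + ze·e_K(p))` (`T_σ` = the `p`-independent tree `Σ_ℓ τ_ℓ(σ)·C_{>Λ_t}(ℓ)` of (Σλ2), `zω, ze` the
wave-function / velocity renormalisation coefficients of (Σλ1)).  The generic route charges this piece at the DOS size (located #22 (C): `≍ U⁴4^{−m}`,
n-independent); here it is charged at the DOS-SLOPE size of brick O5a:

* `klok_bornLines_eq` — the two lines of the STEP at the same label are `(βL²)²·(Ẇ_tΦ_j)(ω² + e_K²)·ĝ²` (dictionary `klfw_sliceLine_eq`/`klfw_memberLine_eq` +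
  `klok_bornKernel_klfb_eq`);
* **`klok_localisedBorn_row_le`** — for `t ∈ [0,1]`, `n + 1 ≤ j`, under the C4a chart hypotheses with `Λ(t) + (4 + 2A)·2π/L < r`:
  `(Λₙ−Λₙ₊₁)((βL²)³)⁻¹·‖Σ_p Σ_σ Ẇ_t(p)(βL²ĝ_p)·Φ_j(t)(p)(βL²ĝ_p)·T_σ(zω·iω_p + ze·e_p)‖ ≤ (Λₙ−Λₙ₊₁)/(βL²)·‖Σ_σ T_σ‖·𝔅(Λ(t), Λ_j)`,
  `𝔅` = the bound of `klok_localisedBorn_sum_norm_le` at the kernel data of `klok_bornKernel_hypotheses` (`M_G = 8/Λ(t)`, `r₁ = Λ(t)/2`, `r₂ = Λ(t)`).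
By value (memo HOME/hubbard-kl-k3c2-p2/g31/LOCALISED-ROW-BY-VALUE.md, [est]): on the ladder `π/β ≤ 16Λₙ₊₁`, so `N = Λ(t)β/π + 1 ≤ 17Λ(t)β/π`, the `β`
and `L²` cancel and the row reads `≲ ‖Σ_σ T_σ‖·(‖zω‖ + ‖ze‖)·(2³²·Λₙ₊₁² + 2³³/L)` for the nearest member (`×(1 + 16^{j−n−1})` deeper); with
`‖ΣT‖ ≲ 4c₄²U²/Λₙ₊₁`, `‖z‖ ≲ 32U²` this is `2³²c₄²·U⁴·4^{−n}` against `frameShiftBar`'s `CR(KlamU)²4^{−n}` and `2⁴²c₄²U⁴·β/L` against the volume share —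
decaying with `n`, unlike the generic route's `≍ U⁴4^{−m}` (located #22 (C)).
Pure composition; no definitions; nothing asserts (c), K3 or superconductivity.  [cite: BenfattoGiulianiMastropietro2006, §2.9]
-/

noncomputable section

namespace Summit.HubbardSuperconductivity.HubbardSuperconductivity.Theorems.KLRegimeSplit

set_option linter.dupNamespace false -- summit = problem name (single-conjunct summit), D-0017

open Real Set Finset Literature.MathematicalPhysics.QuantumLattice Literature.Probability.LatticeModels
open Literature.MathematicalPhysics.QuantumLattice.BandSectorCounting
open Summit.HubbardSuperconductivity.HubbardSuperconductivity.Theorems.TwoPointAssembly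
open Summit.HubbardSuperconductivity.HubbardSuperconductivity.Theorems.KLProgrammeLegKernels
open Summit.HubbardSuperconductivity.HubbardSuperconductivity.Theorems.KLRegimeWick
open Summit.HubbardSuperconductivity.HubbardSuperconductivity.Theorems.EngineV8
open Summit.HubbardSuperconductivity.HubbardSuperconductivity.Theorems.DispersionFlow
open Summit.HubbardSuperconductivity.HubbardSuperconductivity.Theorems.PerturbedFermiCurve

variable {L M : ℕ} [NeZero L] [NeZero M]

/-- **The two born lines at the same label**: `Ẇ_Λ(p)·(βL²ĝ_p) · Φ_{j,Λ}(p)·(βL²ĝ_p) = (βL²)²·(klWd Λ·klPhi Λ_j Λ)(ω_p² + e_p²)·ĝ_p²` (`β ≠ 0`, `Λ ≠ 0`). -/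
theorem klok_bornLines_eq {β : ℝ} (hβ : β ≠ 0) (μ : ℝ) (K : TrigPolyC4v) (n j : ℕ) {Λ : ℝ} (hΛ : Λ ≠ 0) (p : FreqMomentum L M) :
    (((deriv (fun Λ' : ℝ => hubbardCutoffWeightCT L M β μ K Λ' p) Λ : ℝ)) : ℂ) * ((((β * (L : ℝ) ^ 2 : ℝ)) : ℂ) * propCT L M β μ K p) *
        ((((softSymbolCompl L M β μ K (n + 1) j p +
              (hubbardCutoffWeightCT L M β μ K (klScale klE0 (n + 1)) p - hubbardCutoffWeightCT L M β μ K Λ p) : ℝ)) : ℂ) *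
          ((((β * (L : ℝ) ^ 2 : ℝ)) : ℂ) * propCT L M β μ K p)) =
      (((β * (L : ℝ) ^ 2 : ℝ)) : ℂ) ^ 2 *
        (((klWd Λ (matsubaraFreq β M p.1 ^ 2 + nambuXiCT L μ K p.2 ^ 2) * klPhi (klScale klE0 j) Λ (matsubaraFreq β M p.1 ^ 2 + nambuXiCT L μ K p.2 ^ 2) : ℝ) : ℂ) *
          propCT L M β μ K p ^ 2) := by
  rw [klfw_sliceLine_eq μ K hβ hΛ p, klfw_memberLine_eq μ K hβ n j Λ p, mul_mul_mul_comm, klok_bornKernel_klfb_eq hβ μ K Λ (klScale klE0 j) p, ← sq]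

/-- **THE LOCALISED PART OF THE BORN ROW (cure (C′) §2 row 1).**  For `t ∈ [0,1]` (`Λ(t) = Λₙ + t(Λₙ₊₁ − Λₙ)`), a member scale `Λ_j`, the STEP's literal
weights `Φ`, `Wd`, coefficients `T : Fin 2 → ℂ`, `zω ze : ℂ`, slice-weight data `(M_G, ℓ, r₁)` of the kernel `klWd Λ(t)·klPhi Λ_j Λ(t)` (supplied by
`klok_bornKernel_hypotheses`: `M_G = 8/Λ(t)`, `ℓ = 64/(Λ(t)Λ_j²) + (2(448/3)e² + 8)/Λ(t)³`, `r₁ = Λ(t)/2`), under the C4a chart hypotheses with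
`Λ(t) + (4 + 2A)·2π/L < r` and `0 < β`:
`(Λₙ−Λₙ₊₁)((βL²)³)⁻¹·‖Σ_p Σ_σ (Wd t p·βL²ĝ_p)(Φ j t p·βL²ĝ_p)·(T σ·(zω·iω_p + ze·e_p))‖ ≤ (Λₙ−Λₙ₊₁)/(βL²)·‖Σ_σ T σ‖·𝔅`, `𝔅` the bound of
`klok_localisedBorn_sum_norm_le` at `r₂ = Λ(t)` — the DOS-SLOPE size. [cite: BenfattoGiulianiMastropietro2006, §2.9] -/
theorem klok_localisedBorn_row_le {β : ℝ} (hβ : 0 < β) (μ : ℝ) {K : TrigPolyC4v}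
    {a b : ℝ} (B : BandBounds a b) {A : ℝ} (hA : ∀ p : Momentum, ∀ j ≤ 2, ‖iteratedFDeriv ℝ j (frameShift K) p‖ ≤ A) (hADt : 2 * A < B.Dtmin)
    {r : ℝ} (hlo : a < μ - r - A) (hhi : μ + r + A < b) (n : ℕ) {t : ℝ} (ht : t ∈ Icc (0 : ℝ) 1)
    (Φ : ℕ → ℝ → FreqMomentum L M → ℝ) (hΦ : Φ = fun j t k => (softSymbolCompl L M β μ K (n + 1) j) k + (hubbardCutoffWeightCT L M β μ K (klScale klE0 (n + 1)) k -
            hubbardCutoffWeightCT L M β μ K (klScale klE0 n + t * (klScale klE0 (n + 1) - klScale klE0 n)) k))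
    (Wd : ℝ → FreqMomentum L M → ℝ) (hWd : Wd = fun t k => deriv (fun Λ' : ℝ => hubbardCutoffWeightCT L M β μ K Λ' k) (klScale klE0 n + t * (klScale klE0 (n + 1) - klScale klE0 n)))
    (j : ℕ) (hΛr : klScale klE0 n + t * (klScale klE0 (n + 1) - klScale klE0 n) + (4 + 2 * A) * (2 * π / L) < r)
    {Mg ℓ r₁ : ℝ} (hr₁ : 0 < r₁)
    (hbd : ∀ s, |klWd (klScale klE0 n + t * (klScale klE0 (n + 1) - klScale klE0 n)) s *
      klPhi (klScale klE0 j) (klScale klE0 n + t * (klScale klE0 (n + 1) - klScale klE0 n)) s| ≤ Mg)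
    (hlip : ∀ s s', |klWd (klScale klE0 n + t * (klScale klE0 (n + 1) - klScale klE0 n)) s *
        klPhi (klScale klE0 j) (klScale klE0 n + t * (klScale klE0 (n + 1) - klScale klE0 n)) s -
      klWd (klScale klE0 n + t * (klScale klE0 (n + 1) - klScale klE0 n)) s' *
        klPhi (klScale klE0 j) (klScale klE0 n + t * (klScale klE0 (n + 1) - klScale klE0 n)) s'| ≤ ℓ * |s - s'|)
    (hin : ∀ s, s ≤ r₁ ^ 2 → klWd (klScale klE0 n + t * (klScale klE0 (n + 1) - klScale klE0 n)) s *
      klPhi (klScale klE0 j) (klScale klE0 n + t * (klScale klE0 (n + 1) - klScale klE0 n)) s = 0)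
    (hout : ∀ s, (klScale klE0 n + t * (klScale klE0 (n + 1) - klScale klE0 n)) ^ 2 ≤ s →
      klWd (klScale klE0 n + t * (klScale klE0 (n + 1) - klScale klE0 n)) s *
        klPhi (klScale klE0 j) (klScale klE0 n + t * (klScale klE0 (n + 1) - klScale klE0 n)) s = 0)
    (T : Fin 2 → ℂ) (zω ze : ℂ) :
    (klScale klE0 n - klScale klE0 (n + 1)) * ((β * (L : ℝ) ^ 2) ^ 3)⁻¹ *
      ‖∑ p : FreqMomentum L M, ∑ σ : Fin 2,
        (((((Wd t p) : ℝ) : ℂ) * (((β * (L : ℝ) ^ 2 : ℝ) : ℂ) * propCT L M β μ K p)) * ((((Φ j t p) : ℝ) : ℂ) * (((β * (L : ℝ) ^ 2 : ℝ) : ℂ) * propCT L M β μ K p))) *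
          (T σ * (zω * (Complex.I * (matsubaraFreq β M p.1 : ℂ)) + ze * (nambuXiCT L μ K p.2 : ℂ)))‖ ≤
      (klScale klE0 n - klScale klE0 (n + 1)) / (β * (L : ℝ) ^ 2) * ‖∑ σ : Fin 2, T σ‖ *
        ((‖2 * zω + ze‖ * (((klScale klE0 n + t * (klScale klE0 (n + 1) - klScale klE0 n)) * β / π + 1) * (Mg / r₁ ^ 2) +
            2 * (klScale klE0 n + t * (klScale klE0 (n + 1) - klScale klE0 n)) *
              (((klScale klE0 n + t * (klScale klE0 (n + 1) - klScale klE0 n)) * β / π + 1) * (ℓ / r₁ ^ 2 + Mg / r₁ ^ 4)) *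
              (2 * (2 * (klScale klE0 n + t * (klScale klE0 (n + 1) - klScale klE0 n))))) +
          2 * ‖zω + ze‖ * (3 * (2 * (klScale klE0 n + t * (klScale klE0 (n + 1) - klScale klE0 n))) ^ 2 *
              (((klScale klE0 n + t * (klScale klE0 (n + 1) - klScale klE0 n)) * β / π + 1) * (Mg / r₁ ^ 4)) +
            (2 * (klScale klE0 n + t * (klScale klE0 (n + 1) - klScale klE0 n))) ^ 3 *
              (((klScale klE0 n + t * (klScale klE0 (n + 1) - klScale klE0 n)) * β / π + 1) * (ℓ / r₁ ^ 4 + 2 * Mg / r₁ ^ 6)) *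
              (2 * (2 * (klScale klE0 n + t * (klScale klE0 (n + 1) - klScale klE0 n)))))) *
        ((klScale klE0 n + t * (klScale klE0 (n + 1) - klScale klE0 n)) * (((L : ℝ) / (2 * π)) ^ 2 *
          (4 * π * (1 / (B.Dtmin - 2 * A) ^ 2 + Real.pi * Real.sqrt 2 * (2 + 4 * A) / (B.Dtmin - 2 * A) ^ 3) *
              (klScale klE0 n + t * (klScale klE0 (n + 1) - klScale klE0 n)) ^ 2 +
            4 * (2 * π * (π * Real.sqrt 2 / (B.Dtmin - 2 * A))) * ((4 + 2 * A) * (2 * π / L)))))) := by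
  set Λt : ℝ := klScale klE0 n + t * (klScale klE0 (n + 1) - klScale klE0 n) with hΛt
  have hβ0 : β ≠ 0 := hβ.ne'
  have hL : (0 : ℝ) < L := by exact_mod_cast Nat.pos_of_ne_zero (NeZero.ne L)
  have hβL : 0 < β * (L : ℝ) ^ 2 := by positivity
  have hΛn := klth_klScale_pos n
  have hΛ1 := klth_klScale_pos (n + 1)
  have hsucc : klScale klE0 (n + 1) = klScale klE0 n / 4 := klth_klScale_succ n
  have hΛt1 : klScale klE0 (n + 1) ≤ Λt := by rw [hΛt, hsucc]; obtain ⟨h0, h1⟩ := ht; nlinarith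
  have hΛt0 : 0 < Λt := hΛ1.trans_le hΛt1
  -- the double sum factorises: `(βL²)²·(Σ_σ T σ)·Σ_p G(s_p)·ĝ_p²·(zω iω_p + ze e_p)`
  have hlines : ∀ p : FreqMomentum L M,
      (((((Wd t p) : ℝ) : ℂ) * (((β * (L : ℝ) ^ 2 : ℝ) : ℂ) * propCT L M β μ K p)) * ((((Φ j t p) : ℝ) : ℂ) * (((β * (L : ℝ) ^ 2 : ℝ) : ℂ) * propCT L M β μ K p))) =
        (((β * (L : ℝ) ^ 2 : ℝ)) : ℂ) ^ 2 *
          ((((klWd Λt (matsubaraFreq β M p.1 ^ 2 + nambuXiCT L μ K p.2 ^ 2) * klPhi (klScale klE0 j) Λt (matsubaraFreq β M p.1 ^ 2 + nambuXiCT L μ K p.2 ^ 2) : ℝ)) : ℂ) *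
            propCT L M β μ K p ^ 2) := by
    intro p
    rw [hWd, hΦ]
    exact klok_bornLines_eq hβ0 μ K n j hΛt0.ne' p
  have hsum : ∑ p : FreqMomentum L M, ∑ σ : Fin 2,
        (((((Wd t p) : ℝ) : ℂ) * (((β * (L : ℝ) ^ 2 : ℝ) : ℂ) * propCT L M β μ K p)) * ((((Φ j t p) : ℝ) : ℂ) * (((β * (L : ℝ) ^ 2 : ℝ) : ℂ) * propCT L M β μ K p))) *
          (T σ * (zω * (Complex.I * (matsubaraFreq β M p.1 : ℂ)) + ze * (nambuXiCT L μ K p.2 : ℂ))) =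
      (((β * (L : ℝ) ^ 2 : ℝ)) : ℂ) ^ 2 * (∑ σ : Fin 2, T σ) *
        ∑ p : FreqMomentum L M, (((klWd Λt (matsubaraFreq β M p.1 ^ 2 + nambuXiCT L μ K p.2 ^ 2) *
            klPhi (klScale klE0 j) Λt (matsubaraFreq β M p.1 ^ 2 + nambuXiCT L μ K p.2 ^ 2) : ℝ)) : ℂ) *
          (propCT L M β μ K p ^ 2 * (zω * (Complex.I * (matsubaraFreq β M p.1 : ℂ)) + ze * (nambuXiCT L μ K p.2 : ℂ))) := by
    rw [mul_sum]
    refine sum_congr rfl fun p _ => ?_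
    rw [hlines p, ← mul_sum, ← sum_mul]
    ring
  have hker := klok_localisedBorn_sum_norm_le (L := L) (M := M) hβ μ B hA hADt hlo hhi hbd hlip hin hout hr₁ hΛt0 hΛr zω ze
  rw [hsum, norm_mul, norm_mul, norm_pow, Complex.norm_real, Real.norm_of_nonneg hβL.le]
  have hpre : (klScale klE0 n - klScale klE0 (n + 1)) * ((β * (L : ℝ) ^ 2) ^ 3)⁻¹ * ((β * (L : ℝ) ^ 2) ^ 2 * ‖∑ σ : Fin 2, T σ‖ *
      ‖∑ p : FreqMomentum L M, (((klWd Λt (matsubaraFreq β M p.1 ^ 2 + nambuXiCT L μ K p.2 ^ 2) *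
            klPhi (klScale klE0 j) Λt (matsubaraFreq β M p.1 ^ 2 + nambuXiCT L μ K p.2 ^ 2) : ℝ)) : ℂ) *
          (propCT L M β μ K p ^ 2 * (zω * (Complex.I * (matsubaraFreq β M p.1 : ℂ)) + ze * (nambuXiCT L μ K p.2 : ℂ)))‖) =
      (klScale klE0 n - klScale klE0 (n + 1)) / (β * (L : ℝ) ^ 2) * ‖∑ σ : Fin 2, T σ‖ *
      ‖∑ p : FreqMomentum L M, (((klWd Λt (matsubaraFreq β M p.1 ^ 2 + nambuXiCT L μ K p.2 ^ 2) *
            klPhi (klScale klE0 j) Λt (matsubaraFreq β M p.1 ^ 2 + nambuXiCT L μ K p.2 ^ 2) : ℝ)) : ℂ) *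
          (propCT L M β μ K p ^ 2 * (zω * (Complex.I * (matsubaraFreq β M p.1 : ℂ)) + ze * (nambuXiCT L μ K p.2 : ℂ)))‖ := by
    field_simp
  rw [hpre]
  have hfac : 0 ≤ (klScale klE0 n - klScale klE0 (n + 1)) / (β * (L : ℝ) ^ 2) * ‖∑ σ : Fin 2, T σ‖ := by
    have : 0 ≤ klScale klE0 n - klScale klE0 (n + 1) := by rw [hsucc]; linarith
    positivity
  exact mul_le_mul_of_nonneg_left hker hfac

end Summit.HubbardSuperconductivity.HubbardSuperconductivity.Theorems.KLRegimeSplit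

end
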